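import Summits.HodgeConjecture.HodgeConjecture.Theorems.F0P2iRIGinfGlue   -- ★ p819050 (pulls ★ p818525 `F0P2iRIGinfArith`)
import HarnessLib

/-!
# FLOOR-0 P2 — PKΠ RUNG 4, ROW «RIG∞-DISCHARGE»: the RIG∞ node of the v1.4 head, discharged under the archimedean pin (in-house, S)

Cell hodgecm-mathlib (D-0151), FLOOR 0, programme P2 (theta ∕ `hdictE`); crux item H413 = stmt-HodgeConjecture-24833 (`HCCMUnconditional.H413`);
sub-line `Cruxes/H413/Lines/F0_P2PKPiRung4.lean` (F0P2-plan (g6)).  Row «RIG∞-DISCHARGE» dealt 2026-08-31T09:42:07Z to seat B-p18 (g26): the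
NAME-FREE junction of ★ RIG∞″ (`Theorems/F0P2iRIGinfArith.lean`, p818525) with ★ RIG∞-GLUE (`Theorems/F0P2iRIGinfGlue.lean`, p819050) — under
`XiArchPinned L ξ μω k`, (D-μ) any idèle-class character `μ₁` with `toHeckeCharacter L μ₁ = η̃⁻¹ψ̃⁻¹μω` has WEIGHT ONE, and (D-χ) any homomorphism
`χ` on `U(1)(𝔸_{L⁺,f})` satisfying the DICTIONARY (χ_f) clause `χ(z/z̄) = (ψ̃⁻¹(η̃⁻¹ψ̃⁻¹μω)²)((1_∞, z))` is an AUTOMORPHIC character of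
`L¹ \ U(1)(𝔸_{L⁺,f})`.  These two are the RIG∞ node `⟨hw1, haut⟩` of the v1.4 head after `obtain ⟨ξ, hmem, k, hpin⟩ := hS2♯ …`; the GRD witness
(F0P2-p01) and the (N)∕(S) assembly (A-p17) instantiate them at `grdMu` ∕ `grdChi` by one `exact` each.  THEOREMS ONLY (no `def`, no instance, no
notation, no named fact, no `sorry`); never imports a `Cruxes/…/Lines` module; `--supports stmt-HodgeConjecture-24833 --as helper`.  HC_CM is proved
only modulo the printed citations until rung 0 closes; this file discharges none of them.

## References
* [Rogawski1990] J. Rogawski, Ann. of Math. Stud. 123 (1990): Prop. 15.2.1 (b), §12.3 pp. 174–178 (the archimedean pin and the characters `η̃`, `ψ̃`, `μ`).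
* [Liu2021] Y. Liu, Camb. J. Math. 9 (2021): Def. 4.3 (weight), Def. 4.11 (l. 2090) (automorphic characters of `E¹\(𝔸_E^∞)¹`).
-/

set_option autoImplicit false
-- the mandated namespace has the single-problem summit's repeated segment (`HodgeConjecture.HodgeConjecture`)
set_option linter.dupNamespace false

noncomputable section

open NumberField IsDedekindDomain

namespace Summit.HodgeConjecture.HodgeConjecture.Cruxes.H413.F0P2iRIGinfDischarge

open Literature.NumberTheory.Rogawski1990 Literature.NumberTheory.GaloisRepresentations
open Literature.NumberTheory.Automorphic Literature.NumberTheory.Automorphic.IdeleClassGroup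
open Literature.NumberTheory.Automorphic.Liu2021 Literature.NumberTheory.Automorphic.Liu2021.Def411WeilCarriers
open Summit.HodgeConjecture.HodgeConjecture.Cruxes.H413.F0P2iRIGinfArith
open Summit.HodgeConjecture.HodgeConjecture.Cruxes.H413.F0P2iRIGinfGlue

/-- **(D-μ)** Under the archimedean pin `XiArchPinned L ξ μω k`, an idèle-class character `μ₁ : C_L →ₜ* S¹` whose Hecke character is
`η̃⁻¹ · ψ̃⁻¹ · μω` has WEIGHT ONE (`HasWeight L μ₁ 1`): RIG∞″ gives `η̃⁻¹ψ̃⁻¹μω` the unitary type `k − 2eη − 2eψ` with `|·|_w = 1` everywhere, and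
(G-μ′) turns it into the weight. [cite: Rogawski1990, Prop. 15.2.1 (b); §12.3 p. 178] [cite: Liu2021, Def. 4.3] -/
theorem hasWeight_one_of_toHeckeCharacter_eq (L : Type) [Field L] [NumberField L] [IsCMField L] (ξ : OneDimAutRepH L)
    (μω : HeckeCharacter L) (k : InfinitePlace L → ℤ) (hpin : XiArchPinned L ξ μω k) (μ1 : IdeleClassGroup L →ₜ* Circle)
    (hμ1 : toHeckeCharacter L μ1 = ξ.bcη⁻¹ * ξ.bcψ⁻¹ * μω) : HasWeight L μ1 1 :=
  hasWeight_one_of_hasUnitaryArchType_toHeckeCharacter L μ1 _ (hμ1 ▸ (stubRIGinfArith_holds L ξ μω k hpin).2.1)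
    (stubRIGinfArith_holds L ξ μω k hpin).1

/-- **(D-χ)** Under the archimedean pin `XiArchPinned L ξ μω k`, a homomorphism `χ` on `U(1)(𝔸_{L⁺,f})` satisfying the DICTIONARY (χ_f)
clause `χ(z/z̄) = (ψ̃⁻¹ · (η̃⁻¹ψ̃⁻¹μω)²)((1_∞, z))` for every finite idèle `z` of `L` is an automorphic character of `L¹ \ U(1)(𝔸_{L⁺,f})`
(★ `IsAutomorphicOneChar`): RIG∞″ gives `ν := ψ̃⁻¹(η̃⁻¹ψ̃⁻¹μω)²` the unitary type `(0,0)`, and (G-χ′) transfers automorphy through `z ↦ z/z̄`.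
[cite: Rogawski1990, Prop. 15.2.1 (b); §12.3 p. 178] [cite: Liu2021, Def. 4.11 (l. 2090)] -/
theorem isAutomorphicOneChar_of_xiArchPinned (L : Type) [Field L] [NumberField L] [IsCMField L] (ξ : OneDimAutRepH L)
    (μω : HeckeCharacter L) (k : InfinitePlace L → ℤ) (hpin : XiArchPinned L ξ μω k)
    (χ : UnitaryGroup.finAdelicOne (↥(maximalRealSubfield L)) L (IsCMField.complexConj L) →* ℂˣ)
    (hχ : ∀ z : (FiniteAdeleRing (𝓞 L) L)ˣ,
      χ (finAdelicCheck (↥(maximalRealSubfield L)) L (IsCMField.complexConj L)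
          (Def411WeilCarriers.complexConj_mul_complexConj' L) z) =
        (ξ.bcψ⁻¹ * (ξ.bcη⁻¹ * ξ.bcψ⁻¹ * μω) ^ 2)
          (Units.map (N := AdeleRing (𝓞 L) L) (MonoidHom.inr (InfiniteAdeleRing L) (FiniteAdeleRing (𝓞 L) L)) z)) :
    IsAutomorphicOneChar (↥(maximalRealSubfield L)) L (IsCMField.complexConj L) χ :=
  isAutomorphicOneChar_of_finAdelicCheck_eq_hecke L _ (stubRIGinfArith_holds L ξ μω k hpin).2.2 χ hχ

/-- **The RIG∞ node of the v1.4 head, both halves at once**: under the pin, for any `μ₁` with `toHeckeCharacter L μ₁ = η̃⁻¹ψ̃⁻¹μω` and any `χ`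
satisfying the DICTIONARY (χ_f) clause, `HasWeight L μ₁ 1 ∧ IsAutomorphicOneChar L⁺ L c̄ χ`. [cite: Rogawski1990, Prop. 15.2.1 (b); §12.3 p. 178] -/
theorem rigInf_node_of_xiArchPinned (L : Type) [Field L] [NumberField L] [IsCMField L] (ξ : OneDimAutRepH L)
    (μω : HeckeCharacter L) (k : InfinitePlace L → ℤ) (hpin : XiArchPinned L ξ μω k) (μ1 : IdeleClassGroup L →ₜ* Circle)
    (hμ1 : toHeckeCharacter L μ1 = ξ.bcη⁻¹ * ξ.bcψ⁻¹ * μω)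
    (χ : UnitaryGroup.finAdelicOne (↥(maximalRealSubfield L)) L (IsCMField.complexConj L) →* ℂˣ)
    (hχ : ∀ z : (FiniteAdeleRing (𝓞 L) L)ˣ,
      χ (finAdelicCheck (↥(maximalRealSubfield L)) L (IsCMField.complexConj L)
          (Def411WeilCarriers.complexConj_mul_complexConj' L) z) =
        (ξ.bcψ⁻¹ * (ξ.bcη⁻¹ * ξ.bcψ⁻¹ * μω) ^ 2)
          (Units.map (N := AdeleRing (𝓞 L) L) (MonoidHom.inr (InfiniteAdeleRing L) (FiniteAdeleRing (𝓞 L) L)) z)) :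
    HasWeight L μ1 1 ∧ IsAutomorphicOneChar (↥(maximalRealSubfield L)) L (IsCMField.complexConj L) χ :=
  ⟨hasWeight_one_of_toHeckeCharacter_eq L ξ μω k hpin μ1 hμ1, isAutomorphicOneChar_of_xiArchPinned L ξ μω k hpin χ hχ⟩

end Summit.HodgeConjecture.HodgeConjecture.Cruxes.H413.F0P2iRIGinfDischarge

end
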